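import Summits.ABC.IUTFork.Conditional.AbcOfSHregRadicalEpsilon
import Literature.IUT.LogVolume.Corollary22PartIIUpTo
import HarnessLib

/-!
# [IUTchIV] Theorem 1.10 at points of degree `≤ 2` (the cell's typed interface `Cor22.Thm110LegendreUpTo 2`) ⟹
# `rad((4^{m+1}+1)(4^m+1)) ≥ 4^{(1/3 − ε)(m+1)}` for all large `m` — every auxiliary hypothesis discharged in the kernel
# (abc-iut cell, R2 S-chain team, seat abc-iut-s2-p3 gen 2; the interface-level twin of `AbcOfSHregRadicalEpsilon`)

Record-only PROOF file (D-0012) of the abc-iut cell; TAKES NO SIDE on [IUTchIII] Cor. 3.12 or [IUTchIV] Thm. 1.10.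
S. Mochizuki, *IUT IV* [Mochizuki2012], Thm. 1.10 pp. 22–31 (the display `(1/6)·log(q) ≤ (1 + 20·d_mod/l)·(log(𝔡) + log(𝔣)) +
20·(d*_mod·l + η_prm)`), Cor. 2.2 (ii) proof (P1)–(P7) pp. 44–47 [claim: Mochizuki2012, status: disputed] — Theorem 1.10 rests on
[IUTchIII] Cor. 3.12 (DISPUTED); here it enters only through the cell's typed INTERFACE `Cor22.Thm110LegendreUpTo 2` (abc-iut-S2,
`Corollary22PartIIUpTo`: the display at every admissible `λ`-line point of degree `≤ 2`), taken as a HYPOTHESIS, never asserted.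

WHY THIS TWIN. `Conditional.log_radical_ge_of_hreg` (p447879) derives the radical bound from the CONE binder `hreg` of the S_H line of
record via abc-iut-s2-p4's Cor.-3.12-free display on the split-bad locus; `hreg` is a statement about the cell's typed (U)-reading hull
and is under refutation as typed (abc-iut-s2-p5 g2 «HVOL-REFUTATION-QUADWITNESS», 2026-08-26T13:08Z). The derivation below starts one
level up, at the PRINTED SHAPE of Theorem 1.10's conclusion (the interface every reading must deliver), so it records a concrete
Diophantine prediction of [IUTchIV] Thm. 1.10 itself, independent of the (U)/(P) hull typing:

* `SplitBadWindow.radical_ineq_of_display` — at the split-bad point `P_m = (F, i2^m/(1 + i2^{m+1}))` with a prime `l ≥ 7` satisfying (P3)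
  and any `Cor22.Display P_m l η`: `(1/3)·log(1+4^{m+1}) − (1/3)·h^{1/2}·log l − 80·d*·l − 40η ≤ (1 + 40/l)·(2·log-diff + log rad((4^{m+1}+1)(4^m+1)))`
  (the unpacking step of `Conditional.log_radical_lower_bound_of_hreg_of`, display-generic);
* **`Conditional.log_radical_ge_of_thm110LegendreUpTo_two_of`** / **`…_of_thm110LegendreUpTo_two`** — `Cor22.Thm110LegendreUpTo 2` ⟹
  for every `ε > 0` there is `m₁` with `(1/3 − ε)·(m+1)·log 4 ≤ log rad((4^{m+1}+1)·(4^m+1))` for all `m ≥ m₁`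
  (window-admissible primes `SplitBadWindow.exists_admissible_window_of` p446066: (P1)-window, (P2), (P3), (P5), (P6), `P_m ∈ UP ∩ K_V`,
  `AdmitsCore`, degree `2` — all PROVED; then `radical_bound_reduction` + Young, p447879);
* **`Conditional.radical_ge_rpow_of_thm110Legendre`** — from the full interface `Cor22.Thm110Legendre` (the hypothesis of the
  campaign-S endpoint `Cor22.abc_of_thm110Legendre`): `4^{(1/3 − ε)(m+1)} ≤ rad((4^{m+1}+1)(4^m+1))` for all large `m`.

READING (for the planners; nothing asserted about print or any author): a statement about the integers `4^n + 1` only, conditional on the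
typed Thm-1.10 interface at degree-2 points and on nothing else; unconditionally such a radical bound is open (under abc: exponent `1 − ε`).
HONEST SCOPE: consequences of a typed hypothesis; typed ≠ proved; nothing here asserts Thm 1.10, Cor 3.12 or abc; no side taken.
PROOF-ONLY file: no definitions, no `Prop` facts. [cite: Mochizuki2012, IUTchIV Thm. 1.10 pp. 22–31]
[cite: Mochizuki2012, IUTchIV Cor. 2.2 (ii) proof (P1)–(P7) p. 44–47]
-/

noncomputable section

namespace Summit.ABC.IUTFork

open NumberField IsDedekindDomain Finset
open Literature.IUT.HodgeTheaters Literature.IUT.LogVolume Literature.IUT.LogVolume.Cor22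
open Literature.NumberTheory.DiophantineGeometry Literature.NumberTheory.DiophantineGeometry.GenEll
open Summit.ABC.ABC.Theorems
open scoped Classical

namespace SplitBadWindow

open SplitBadWitness

variable {F : Type} [Field F] [NumberField F] {ζ : 𝓞 F}

/-- **Unpacking Thm. 1.10's display at `P_m`** (display-generic form of the step inside `Conditional.log_radical_lower_bound_of_hreg_of`):
for `l` prime with (P3) at `(P_m, l)` and `Cor22.Display P_m l η`,
`(1/3)·log(1+4^{m+1}) − (1/3)·h^{1/2}·log l − 80·d*·l − 40·η ≤ (1 + 40/l)·(2·log-diff(P_m) + log rad((4^{m+1}+1)(4^m+1)))` (`d_mod ≤ 2`,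
`log(q^{∤{2,l}}) ≥ log(1+4^{m+1}) − h^{1/2}·log l`, `2·log-cond ≤ log rad`). [cite: Mochizuki2012, IUTchIV Thm. 1.10 pp. 22–31]
[claim: Mochizuki2012, status: disputed] -/
theorem radical_ineq_of_display [IsCyclotomicExtension {4} ℚ F] (hζ : IsPrimitiveRoot ζ 4) (m : ℕ) {l : ℕ}
    (hlp : l.Prime)
    (hP3 : ∀ v ∈ badPlaces (⟨F, (ζ : F) * 2 ^ m / (1 + (ζ : F) * 2 ^ (m + 1))⟩ : NFPoint), residueChar F v = l →
      localHeight (⟨F, (ζ : F) * 2 ^ m / (1 + (ζ : F) * 2 ^ (m + 1))⟩ : NFPoint) v <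
        Real.sqrt (logQForall (⟨F, (ζ : F) * 2 ^ m / (1 + (ζ : F) * 2 ^ (m + 1))⟩ : NFPoint)))
    {η : ℝ} (hdisp : Cor22.Display (⟨F, (ζ : F) * 2 ^ m / (1 + (ζ : F) * 2 ^ (m + 1))⟩ : NFPoint) l η) :
    1 / 3 * Real.log (1 + 4 ^ (m + 1))
        - 1 / 3 * Real.sqrt (logQForall (⟨F, (ζ : F) * 2 ^ m / (1 + (ζ : F) * 2 ^ (m + 1))⟩ : NFPoint)) * Real.log l
        - 80 * (2 ^ 12 * 3 ^ 3 * 5) * l - 40 * η ≤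
      (1 + 40 / (l : ℝ)) *
        (2 * (⟨F, (ζ : F) * 2 ^ m / (1 + (ζ : F) * 2 ^ (m + 1))⟩ : NFPoint).logDiff +
          Real.log (UniqueFactorizationMonoid.radical ((4 ^ (m + 1) + 1) * (4 ^ m + 1)) : ℕ)) := by
  set Pm : NFPoint := ⟨F, (ζ : F) * 2 ^ m / (1 + (ζ : F) * 2 ^ (m + 1))⟩ with hPm
  have hD : 1 / 6 * logQAvoid Pm {2, l} ≤
      (1 + 20 * (dmod Pm : ℝ) / l) * (Pm.logDiff + logCondAvoid Pm {2, l})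
        + 20 * (2 ^ 12 * 3 ^ 3 * 5 * (dmod Pm : ℝ) * l + η) := hdisp
  have hl0 : (0 : ℝ) < l := by exact_mod_cast hlp.pos
  have hd2' : dmod Pm ≤ 2 := dmod_le_two (F := F) _
  have hd2 : (dmod Pm : ℝ) ≤ 2 := by exact_mod_cast hd2'
  have hd0 : (0 : ℝ) ≤ dmod Pm := by positivity
  have hDC0 : 0 ≤ Pm.logDiff + logCondAvoid Pm {2, l} :=
    add_nonneg (NFPoint.logDiff_nonneg _) (logCondAvoid_nonneg _ _)
  have hcoef : (1 + 20 * (dmod Pm : ℝ) / l) * (Pm.logDiff + logCondAvoid Pm {2, l}) ≤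
      (1 + 40 / (l : ℝ)) * (Pm.logDiff + logCondAvoid Pm {2, l}) := by
    refine mul_le_mul_of_nonneg_right ?_ hDC0
    have : 20 * (dmod Pm : ℝ) / l ≤ 40 / l := by
      rw [div_le_div_iff_of_pos_right hl0]; linarith
    linarith
  have hconst : 20 * (2 ^ 12 * 3 ^ 3 * 5 * (dmod Pm : ℝ) * l + η) ≤ 40 * (2 ^ 12 * 3 ^ 3 * 5) * l + 20 * η := by
    nlinarith
  have hq := log_sub_le_logQAvoid hζ m hlp hP3
  have hrad := two_mul_logCondAvoid_le_log_radical hζ m l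
  have hc40 : (0 : ℝ) ≤ 1 + 40 / (l : ℝ) := by positivity
  have hkey : (1 + 40 / (l : ℝ)) * (2 * (Pm.logDiff + logCondAvoid Pm {2, l})) ≤
      (1 + 40 / (l : ℝ)) * (2 * Pm.logDiff +
        Real.log (UniqueFactorizationMonoid.radical ((4 ^ (m + 1) + 1) * (4 ^ m + 1)) : ℕ)) :=
    mul_le_mul_of_nonneg_left (by linarith) hc40
  nlinarith

end SplitBadWindow

namespace Conditional

open SplitBadWitness SplitBadWindow

/-- **`Cor22.Thm110LegendreUpTo 2` ⟹ `(1/3 − ε)·(m+1)·log 4 ≤ log rad((4^{m+1}+1)(4^m+1))` for all large `m`** (any model `F` of `ℚ(i)`,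
`i = ζ`). The interface is used ONLY at the degree-2 points `P_m` with the window-admissible primes of p446066 (all of (P1), (P2), (P3),
(P5), (P6), `UP`, `K_V`, `AdmitsCore` PROVED); then `radical_ineq_of_display`, the height bound `exists_logQForall_le`, the reduction
`radical_bound_reduction` and the Young step of p447879. CONDITIONAL on the typed interface; nothing asserted about print; no side taken.
[cite: Mochizuki2012, IUTchIV Thm. 1.10 pp. 22–31] [claim: Mochizuki2012, status: disputed] -/
theorem log_radical_ge_of_thm110LegendreUpTo_two_of (F : Type) [Field F] [NumberField F] [IsCyclotomicExtension {4} ℚ F]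
    {ζ : 𝓞 F} (hζ : IsPrimitiveRoot ζ 4) (h110 : Cor22.Thm110LegendreUpTo 2) {ε : ℝ} (hε : 0 < ε) :
    ∃ m₁ : ℕ, ∀ m : ℕ, m₁ ≤ m →
      (1 / 3 - ε) * ((m : ℝ) + 1) * Real.log 4 ≤
        Real.log (UniqueFactorizationMonoid.radical ((4 ^ (m + 1) + 1) * (4 ^ m + 1)) : ℕ) := by
  obtain ⟨η, hη⟩ := exists_isEtaPrm
  obtain ⟨A, B, hA, hB, hAB⟩ := exists_logQForall_le (F := F) ζ
  obtain ⟨m₀, hm₀⟩ := SplitBadWindow.exists_admissible_window_of F hζ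
  have hlog4 : 0 < Real.log 4 := Real.log_pos (by norm_num)
  have hη0 : 0 < η := hη.1
  -- the constants of the reduction (as in `log_radical_ge_of_hreg_of`)
  set δ : ℝ := delta 2 with hδdef
  have hδ1 : 1 ≤ δ := by rw [hδdef]; simp [delta]; norm_num
  set c : ℝ := Real.sqrt (Real.sqrt (2 * δ)) with hc
  set K : ℝ := 2 / 3 * Real.sqrt (40 * δ * c) + 3200 * (2 ^ 12 * 3 ^ 3 * 5) * δ * c + 120 with hK
  have hK0 : 0 ≤ K := by positivity
  set D : ℝ := (⟨F, (0 : F)⟩ : NFPoint).logDiff with hD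
  have hD0 : 0 ≤ D := NFPoint.logDiff_nonneg _
  set C₀ : ℝ := 40 * η + 14 * D with hC₀
  have hC₀0 : 0 ≤ C₀ := by positivity
  set t : ℝ := ε * Real.log 4 / (6 * (K * B + 1)) with ht
  have hKB : 0 < K * B + 1 := by positivity
  have ht0 : 0 < t := by positivity
  have htKB : K * B * t ≤ ε * Real.log 4 / 6 := by
    rw [ht]
    have : K * B * (ε * Real.log 4 / (6 * (K * B + 1))) = (K * B / (K * B + 1)) * (ε * Real.log 4 / 6) := by
      field_simp
    rw [this]
    have h1 : K * B / (K * B + 1) ≤ 1 := by rw [div_le_one hKB]; linarith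
    exact mul_le_of_le_one_left (by positivity) h1
  set M : ℝ := (K * t * A + K * t⁻¹ ^ 7 + C₀) / (5 * ε * Real.log 4 / 6) with hM
  refine ⟨max m₀ ⌈M⌉₊, fun m hm => ?_⟩
  have hmm0 : m₀ ≤ m := (le_max_left _ _).trans hm
  have hmM : M ≤ m := le_trans (Nat.le_ceil _) (by exact_mod_cast (le_max_right _ _).trans hm)
  obtain ⟨l, hlp, hl7, hP2, hP5, hP6, hP3, hlo, hhi, hh⟩ := hm₀ m hmm0
  set Pm : NFPoint := ⟨F, (ζ : F) * 2 ^ m / (1 + (ζ : F) * 2 ^ (m + 1))⟩ with hPm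
  -- the interface at the degree-2 point `P_m`
  have hdeg : Pm.degree ≤ 2 := by
    change Module.finrank ℚ F ≤ 2
    rw [finrank_eq_two F]
  have hdisp : Cor22.Display Pm l η :=
    h110 η hη Pm (mem_UP hζ m) hdeg l hlp (by omega) (admitsCore hζ m) hP2 hP5 hP6
  have hineq := radical_ineq_of_display hζ m hlp hP3 hdisp
  set h : ℝ := logQForall Pm with hhdef
  set R : ℝ := Real.log (UniqueFactorizationMonoid.radical ((4 ^ (m + 1) + 1) * (4 ^ m + 1)) : ℕ) with hRdef
  have hR0 : 0 ≤ R := Real.log_nonneg (by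
    exact_mod_cast Nat.one_le_iff_ne_zero.mpr UniqueFactorizationMonoid.radical_ne_zero)
  have hRle : R ≤ 2 * ((m : ℝ) + 1) * Real.log 4 := log_radical_le m
  have hl7' : (7 : ℝ) ≤ l := by exact_mod_cast hl7
  have hDm : Pm.logDiff = D := rfl
  rw [hDm] at hineq
  have hred := radical_bound_reduction (m := m) hδ1 (by positivity : (0 : ℝ) ≤ 2 ^ 12 * 3 ^ 3 * 5) hD0 hR0 hRle hl7' hh hlo hhi hineq
  rw [← hc, ← hK, ← hC₀] at hred
  -- `v⁸ = h ≤ A + B m`, Young, threshold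
  set v : ℝ := Real.sqrt (Real.sqrt (Real.sqrt h)) with hv
  have hm0' : (0 : ℝ) ≤ m := Nat.cast_nonneg m
  have hh1 : 1 ≤ h := by linarith
  have hv0 : 0 ≤ v := Real.sqrt_nonneg _
  have hv8 : v ^ 8 = h := by
    have hs0 : 0 ≤ Real.sqrt h := Real.sqrt_nonneg _
    have hss0 : 0 ≤ Real.sqrt (Real.sqrt h) := Real.sqrt_nonneg _
    have hv2 : v ^ 2 = Real.sqrt (Real.sqrt h) := Real.sq_sqrt hss0
    have hu2 : Real.sqrt (Real.sqrt h) ^ 2 = Real.sqrt h := Real.sq_sqrt hs0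
    have hs2 : Real.sqrt h ^ 2 = h := Real.sq_sqrt (by linarith)
    rw [show v ^ 8 = ((v ^ 2) ^ 2) ^ 2 by ring, hv2, hu2, hs2]
  have hhA : h ≤ A + B * m := hAB m
  have hyoung := pow_seven_le hv0 ht0
  have hv7 : v ^ 7 ≤ t * (A + B * m) + t⁻¹ ^ 7 := by
    have : t * v ^ 8 ≤ t * (A + B * m) := by
      rw [hv8]; exact mul_le_mul_of_nonneg_left hhA ht0.le
    linarith
  have hKv : K * v ^ 7 ≤ K * (t * (A + B * m) + t⁻¹ ^ 7) := mul_le_mul_of_nonneg_left hv7 hK0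
  have hthr : K * t * A + K * t⁻¹ ^ 7 + C₀ ≤ 5 * ε * Real.log 4 / 6 * m := by
    have hpos : 0 < 5 * ε * Real.log 4 / 6 := by positivity
    rw [hM, div_le_iff₀ hpos] at hmM
    linarith
  have hKBm : K * B * t * m ≤ ε * Real.log 4 / 6 * m := mul_le_mul_of_nonneg_right htKB hm0'
  have e : K * (t * (A + B * m) + t⁻¹ ^ 7) = K * t * A + K * B * t * m + K * t⁻¹ ^ 7 := by ring
  rw [e] at hKv
  have hεm : 0 ≤ ε * Real.log 4 := by positivity
  linarith

/-- **`Cor22.Thm110LegendreUpTo 2` ⟹ `(1/3 − ε)·(m+1)·log 4 ≤ log rad((4^{m+1}+1)(4^m+1))` for all large `m`**, over `ℚ(i) = CyclotomicField 4 ℚ`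
(absolute form). CONDITIONAL on the typed Thm-1.10 interface at degree-2 points; nothing asserted about print; no side taken.
[cite: Mochizuki2012, IUTchIV Thm. 1.10 pp. 22–31] [claim: Mochizuki2012, status: disputed] -/
theorem log_radical_ge_of_thm110LegendreUpTo_two (h110 : Cor22.Thm110LegendreUpTo 2) {ε : ℝ} (hε : 0 < ε) :
    ∃ m₁ : ℕ, ∀ m : ℕ, m₁ ≤ m →
      (1 / 3 - ε) * ((m : ℝ) + 1) * Real.log 4 ≤
        Real.log (UniqueFactorizationMonoid.radical ((4 ^ (m + 1) + 1) * (4 ^ m + 1)) : ℕ) := by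
  haveI : IsCyclotomicExtension {4} ℚ (CyclotomicField 4 ℚ) := CyclotomicField.isCyclotomicExtension 4 ℚ
  exact log_radical_ge_of_thm110LegendreUpTo_two_of (CyclotomicField 4 ℚ)
    (IsCyclotomicExtension.zeta_spec 4 ℚ (CyclotomicField 4 ℚ)).toInteger_isPrimitiveRoot h110 hε

/-- **The campaign-S interface `Cor22.Thm110Legendre` ([IUTchIV] Thm. 1.10 as applied in Cor. 2.2 (ii), the hypothesis of
`Cor22.abc_of_thm110Legendre`) ⟹ `4^{(1/3 − ε)(m+1)} ≤ rad((4^{m+1}+1)·(4^m+1))` for all large `m`** (`^` = `Real.rpow`): a concrete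
Diophantine prediction of the typed Theorem-1.10 interface, all auxiliary hypotheses discharged. CONDITIONAL; nothing asserted about print or
about any author; nothing here asserts Thm 1.10, [IUTchIII] Cor. 3.12 or abc; no side taken. [cite: Mochizuki2012, IUTchIV Thm. 1.10 pp. 22–31]
[claim: Mochizuki2012, status: disputed] -/
theorem radical_ge_rpow_of_thm110Legendre (h110 : Cor22.Thm110Legendre) {ε : ℝ} (hε : 0 < ε) :
    ∃ m₁ : ℕ, ∀ m : ℕ, m₁ ≤ m →
      (4 : ℝ) ^ ((1 / 3 - ε) * ((m : ℝ) + 1)) ≤ (UniqueFactorizationMonoid.radical ((4 ^ (m + 1) + 1) * (4 ^ m + 1)) : ℕ) := by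
  obtain ⟨m₁, hm₁⟩ := log_radical_ge_of_thm110LegendreUpTo_two (thm110LegendreUpTo_of_thm110Legendre h110 2) hε
  refine ⟨m₁, fun m hm => ?_⟩
  have h := hm₁ m hm
  have hr0 : (0 : ℝ) < (UniqueFactorizationMonoid.radical ((4 ^ (m + 1) + 1) * (4 ^ m + 1)) : ℕ) := by
    exact_mod_cast Nat.pos_of_ne_zero UniqueFactorizationMonoid.radical_ne_zero
  rw [Real.rpow_def_of_pos (by norm_num : (0 : ℝ) < 4), ← Real.le_log_iff_exp_le hr0]
  linarith

end Conditional

end Summit.ABC.IUTFork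

end
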